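import Summits.HodgeConjecture.HodgeConjecture.Theorems.K2E5QuatGramNondegenerate     -- ★ (p16): `mulVec_quatGramReal_bijective` (+ ★ #3g `K2E5QuatZetaDefs`, ★ `K2E5QuatAdelicCoordinates`)
import Literature.NumberTheory.Automorphic.AdelicPiSchwartzBruhatFourier              -- ★ `tsum_eq_inv_measure_mul_tsum_adelicPiFourier` (Poisson for `𝒮(𝔸_K^ι)`), `adelicPiFourier`
import HarnessLib

/-!
# K2 ∕ E5 «TamagawaUnitary», unit G «ZETA» — G3-support `K2E5QuatPoissonTransport`: POISSON SUMMATION ON `D_h ⊂ D_{h,𝔸}`, transported from `(L⁺)⁴ ⊂ 𝔸⁺⁴`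

Cell `hodgecm-mathlib` (Track B «K2-LIT»), item h413 = `stmt-HodgeConjecture-24833`, route of record `route-HodgeConjecture-HCCMUnconditional`;
dealt BY NAME by K2E5-plan (g0), DEALS E5 BATCH #8 (h) (2026-09-03T23:12:18Z), to base K2E5-p14; author K2E5-p14 (g0).  PROOF lane (theorems only,
`--supports stmt-HodgeConjecture-24833 --as helper`); the heads below are quoted BY NAME by the unit-G socket G3 `Zeta.sig_K2E5QuatZetaResidue`
(Tate–Fujisaki for `D_h`: the theta-series ∕ unfolding step) at its next edition.

Setting (★ #3g `K2E5QuatZetaDefs`, ★ `K2E5QuatAdelicCoordinates`): `L` CM, `L⁺ = maximalRealSubfield L`, `𝔸⁺ = AdeleRing (𝓞 L⁺) L⁺`, `h = Ha` a hermitian plane with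
`det h ≠ 0`, `D_h = quatRatSubalgebra L Ha ⊂ M₂(L)` (a quaternion algebra over `L⁺`), `e = quatBasis` (an `L⁺`-basis), the coordinates
`quatCoord L e : 𝔸⁺⁴ →+ M₂(𝔸_L)` (an isomorphism onto `D_{h,𝔸}`, ★ `quatCoordEquiv`), `𝒮(D_{h,𝔸}) = quatSchwartzBruhat L e` (pull-back of ★ `piSchwartzBruhat L⁺ (Fin 4)`),
the Gram matrix `G = quatGramReal ∈ GL₄(L⁺)` of `trd` (★ p16 `isUnit_quatGramReal`) and the trd-Fourier transform in coordinates ★ `quatFourierCoord`.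

Content (all CONVENTION-FREE: any additive Haar measure `ν4` on `𝔸⁺⁴`, e.g. G3's `Measure.pi fun _ => ν`; Tate's domain `D⁴ = piFundamentalDomain L⁺ (Fin 4)`):
* §1 `coe_equivFun_symm_quatBasis`, `tsum_quatRatSubalgebra_eq_tsum_coord` — sums over the rational quaternions `D_h` ARE sums over the lattice `(L⁺)⁴`
  of coordinates (`x = ∑ ξᵢ eᵢ`; Mathlib `Basis.equivFun`, `Equiv.tsum_eq`); `map_coe_quatRatSubalgebra_eq_quatCoord` (`x ⊗ 1 = quatCoord e (ξ ⊗ 1)`, ★ `quatCoord_algebraMap`).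
* §2 **`tsum_quatRat_eq_inv_measure_mul_tsum_adelicPiFourier`** — POISSON ON `D_h` (coordinate pairing): for `Φ ∈ 𝒮(D_{h,𝔸})`,
  `∑_{x ∈ D_h} Φ(x ⊗ 1) = ν4(D⁴)⁻¹ · ∑_{ξ ∈ (L⁺)⁴} (Φ ∘ quatCoord e)^(ξ ⊗ 1)` (★ `tsum_eq_inv_measure_mul_tsum_adelicPiFourier` at `K = L⁺`, `ι = Fin 4`).
* §3 **`tsum_quatRat_eq_inv_measure_mul_tsum_quatFourierCoord`** — POISSON ON `D_h` FOR THE REDUCED-TRACE PAIRING `ψ_{L⁺}(trd(x y))`: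
  `∑_{x ∈ D_h} Φ(x ⊗ 1) = ν4(D⁴)⁻¹ · ∑_{y ∈ D_h} Φ̂(y ⊗ 1)`, `Φ̂(y ⊗ 1) := quatFourierCoord L ν4 G e Φ (repr y ⊗ 1)` — because at rational arguments
  `quatFourierCoord … (η ⊗ 1) = (Φ ∘ quatCoord e)^((G η) ⊗ 1)` (`quatFourierCoord_algebraMap`, Mathlib `RingHom.map_mulVec`) and `η ↦ G η` permutes `(L⁺)⁴`
  (★ `mulVec_quatGramReal_bijective`): `tsum_adelicPiFourier_eq_tsum_quatFourierCoord`.  [VignerasLNM800, Ch. III §2, proof of Thm. 2.2: «formule de Poisson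
  ∑_{x ∈ X_K} Φ(x) = ∑_{x ∈ X_K} Φ*(x)» for `X = H`, with the self-dual measure; here for ANY `ν4` with Tate's factor `ν4(D⁴)⁻¹`.]

What is deliberately NOT here (ED. 2, reported on the bus 2026-09-03T23:15Z): the DILATION half — `𝒮(D_{h,𝔸})` is stable under `Φ ↦ Φ(x · )`, `x ∈ (D_h ⊗ 𝔸)^×`,
and the module of `y ↦ x y` on `D_{h,𝔸}` is ★ `quatModule L Ha x = |det x|_{𝔸_L}` (road: `M₂(𝔸_L) = D_{h,𝔸} ⊕ μ·D_{h,𝔸}` equivariantly, so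
`Δ_{M₂(𝔸_L)}(x) = Δ_{D_{h,𝔸}}(x)²`, and ★ `distribHaarChar_matrix_adele_eq_adelicAbsDet_pow`).

HONEST LABEL: HC_CM is proved only modulo the 7 printed citations (2 remaining named inputs: hLiu418 = stmt-HodgeConjecture-24832,
h413 = stmt-HodgeConjecture-24833) until rung 0 closes; this file is a support lemma for socket G3 of ONE tier-1 unit and discharges no socket by itself.

AUDIT (materialised pages; `book:vignerasnd-arithmetique-des-algebres-de-quaternions` = V80): V80 p0062.txt (Ch. III §2, proof of Thm. 2.2: the Poisson formula
on `X_K ⊂ X_A` and the functional equation of `Z_X(Φ, s)`); V80 p0053.txt:L26 «la trace réduite t_A : H_A → A».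

## References
* [VignerasLNM800] M.-F. Vignéras, *Arithmétique des algèbres de quaternions*, LNM 800, Springer 1980 — Ch. III §2, Thm. 2.2 and its proof (Poisson on `X_K ⊂ X_A`).
* [CasselsFrohlichANT1967] J. Tate, *Fourier analysis in number fields and Hecke's zeta-functions*, in Cassels–Fröhlich (eds.), *Algebraic Number Theory* (1967),
  Ch. XV, Lemma 4.2.4 (Poisson for the vector group) and Thm. 4.2.1.
* [WeilBNT1967] A. Weil, *Basic Number Theory* (1967), Ch. VII §2 (standard functions and Fourier transforms on `X_A` for a simple algebra).
-/

set_option autoImplicit false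
set_option linter.dupNamespace false

noncomputable section

namespace Summit.HodgeConjecture.HodgeConjecture.Cruxes.H413.K2E5QuatPoissonTransport

open MeasureTheory NumberField IsDedekindDomain
open Literature.NumberTheory.Automorphic
open Summit.HodgeConjecture.HodgeConjecture.Cruxes.H413.K2E5QuatAdelicMatrixModel
open Summit.HodgeConjecture.HodgeConjecture.Cruxes.H413.K2E5QuatZeta
open Summit.HodgeConjecture.HodgeConjecture.Cruxes.H413.K2E5QuatGramNondegenerate
open scoped Matrix

variable (L : Type) [Field L] [NumberField L] [IsCMField L] {Ha : Matrix (Fin 2) (Fin 2) L}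

/-! ## §1 Sums over `D_h` are sums over the coordinate lattice `(L⁺)⁴` -/

/-- **Coordinates of a rational quaternion**: `(∑ᵢ ξᵢ eᵢ : D_h)`, read in `M₂(L)`, is `∑ᵢ (ξᵢ : L) • eᵢ` (Mathlib `Basis.equivFun_symm_apply`; the `L⁺`-action on
`M₂(L)` is through `L⁺ ⊆ L`). [cite: VignerasLNM800, Ch. I §1 (coordonnées sur une base)] -/
theorem coe_equivFun_symm_quatBasis (hHa : (Ha.map (cmConjRingHom L)).transpose = Ha) (hdet : Ha.det ≠ 0) (ξ : Fin 4 → ↥(maximalRealSubfield L)) :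
    (((quatBasis L Ha hHa hdet).equivFun.symm ξ : ↥(quatRatSubalgebra L Ha)) : Matrix (Fin 2) (Fin 2) L) =
      ∑ i, (ξ i : L) • ((quatBasis L Ha hHa hdet i : ↥(quatRatSubalgebra L Ha)) : Matrix (Fin 2) (Fin 2) L) := by
  rw [Module.Basis.equivFun_symm_apply]
  change (quatRatSubalgebra L Ha).val (∑ i, ξ i • quatBasis L Ha hHa hdet i) = _
  rw [map_sum]
  refine Finset.sum_congr rfl fun i _ => ?_
  rw [map_smul, ← algebraMap_smul L (ξ i)]
  rfl

/-- **Sums over `D_h` are sums over `(L⁺)⁴`**: for any function `f` on `M₂(L)` with values in a topological additive commutative monoid,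
`∑_{x ∈ D_h} f(x) = ∑_{ξ ∈ (L⁺)⁴} f(∑ᵢ ξᵢ eᵢ)` (unconditional sums; reindexing along the `L⁺`-basis `e = quatBasis`, Mathlib `Equiv.tsum_eq`).
[cite: VignerasLNM800, Ch. III §2 (X_K = K-points of X, summed over a K-basis)] -/
theorem tsum_quatRatSubalgebra_eq_tsum_coord {E : Type*} [AddCommMonoid E] [TopologicalSpace E]
    (hHa : (Ha.map (cmConjRingHom L)).transpose = Ha) (hdet : Ha.det ≠ 0) (f : Matrix (Fin 2) (Fin 2) L → E) :
    ∑' x : ↥(quatRatSubalgebra L Ha), f x =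
      ∑' ξ : Fin 4 → ↥(maximalRealSubfield L), f (∑ i, (ξ i : L) • ((quatBasis L Ha hHa hdet i : ↥(quatRatSubalgebra L Ha)) : Matrix (Fin 2) (Fin 2) L)) := by
  rw [← Equiv.tsum_eq (quatBasis L Ha hHa hdet).equivFun.symm.toEquiv]
  refine tsum_congr fun ξ => ?_
  rw [LinearEquiv.coe_toEquiv, coe_equivFun_symm_quatBasis]

/-- **`x ⊗ 1 = quatCoord e (ξ ⊗ 1)`** for `x = ∑ᵢ ξᵢ eᵢ ∈ D_h`: the diagonal image in `M₂(𝔸_L)` of a rational quaternion is the coordinate map at the principal adelic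
vector of its coordinates (★ `quatCoord_algebraMap`). [cite: VignerasLNM800, Ch. III §1 (X_K ↪ X_A)] -/
theorem map_sum_smul_quatBasis_eq_quatCoord (hHa : (Ha.map (cmConjRingHom L)).transpose = Ha) (hdet : Ha.det ≠ 0)
    (ξ : Fin 4 → ↥(maximalRealSubfield L)) :
    (∑ i, (ξ i : L) • ((quatBasis L Ha hHa hdet i : ↥(quatRatSubalgebra L Ha)) : Matrix (Fin 2) (Fin 2) L)).map (algebraMap L (AdeleRing (𝓞 L) L)) =
      quatCoord L (fun i => ((quatBasis L Ha hHa hdet i : ↥(quatRatSubalgebra L Ha)) : Matrix (Fin 2) (Fin 2) L))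
        (fun i => algebraMap (↥(maximalRealSubfield L)) (AdeleRing (𝓞 ↥(maximalRealSubfield L)) ↥(maximalRealSubfield L)) (ξ i)) :=
  (quatCoord_algebraMap L _ ξ).symm

/-! ## §2 Poisson summation on `D_h ⊂ D_{h,𝔸}` — coordinate pairing -/

section Poisson

variable [MeasurableSpace (AdeleRing (𝓞 ↥(maximalRealSubfield L)) ↥(maximalRealSubfield L))]
  [BorelSpace (AdeleRing (𝓞 ↥(maximalRealSubfield L)) ↥(maximalRealSubfield L))]
  (ν4 : Measure (Fin 4 → AdeleRing (𝓞 ↥(maximalRealSubfield L)) ↥(maximalRealSubfield L))) [ν4.IsAddHaarMeasure]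

/-- **POISSON SUMMATION ON `D_h ⊂ D_{h,𝔸}` (coordinate pairing, convention-free).**  For an additive Haar measure `ν4` on `𝔸⁺⁴` and a Schwartz–Bruhat function
`Φ` on `D_{h,𝔸}` (★ `quatSchwartzBruhat L e`: `Φ ∘ quatCoord e ∈ 𝒮(𝔸⁺⁴)`):
`∑_{x ∈ D_h} Φ(x ⊗ 1) = ν4(D⁴)⁻¹ · ∑_{ξ ∈ (L⁺)⁴} (Φ ∘ quatCoord e)^(ξ ⊗ 1)`, `D⁴` Tate's domain, `F^(η) = ∫ F(v) ψ_{L⁺}(∑ ηᵢvᵢ) dν4` (★ `adelicPiFourier`); both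
sums converge absolutely (★ `summable_norm_of_mem_piSchwartzBruhat`, ★ `summable_norm_adelicPiFourier_of_mem_piSchwartzBruhat`).  This is ★ Tate's Lemma 4.2.4
for `𝔸⁺⁴` (★ `tsum_eq_inv_measure_mul_tsum_adelicPiFourier`) transported along the basis `e` (§1).
[cite: VignerasLNM800, Ch. III §2 (formule de Poisson, proof of Thm. 2.2)] [cite: CasselsFrohlichANT1967, Ch. XV Lemma 4.2.4] -/
theorem tsum_quatRat_eq_inv_measure_mul_tsum_adelicPiFourier (hHa : (Ha.map (cmConjRingHom L)).transpose = Ha) (hdet : Ha.det ≠ 0)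
    {Φ : Matrix (Fin 2) (Fin 2) (AdeleRing (𝓞 L) L) → ℂ}
    (hΦ : Φ ∈ quatSchwartzBruhat L (fun i => ((quatBasis L Ha hHa hdet i : ↥(quatRatSubalgebra L Ha)) : Matrix (Fin 2) (Fin 2) L))) :
    ∑' x : ↥(quatRatSubalgebra L Ha), Φ ((x : Matrix (Fin 2) (Fin 2) L).map (algebraMap L (AdeleRing (𝓞 L) L))) =
      (ν4 (piFundamentalDomain (↥(maximalRealSubfield L)) (Fin 4))).toReal⁻¹ *
        ∑' ξ : Fin 4 → ↥(maximalRealSubfield L),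
          adelicPiFourier (↥(maximalRealSubfield L)) (Fin 4) ν4
            (fun a => Φ (quatCoord L (fun i => ((quatBasis L Ha hHa hdet i : ↥(quatRatSubalgebra L Ha)) : Matrix (Fin 2) (Fin 2) L)) a))
            (fun i => algebraMap (↥(maximalRealSubfield L)) (AdeleRing (𝓞 ↥(maximalRealSubfield L)) ↥(maximalRealSubfield L)) (ξ i)) := by
  rw [tsum_quatRatSubalgebra_eq_tsum_coord L hHa hdet
    (fun m : Matrix (Fin 2) (Fin 2) L => Φ (m.map (algebraMap L (AdeleRing (𝓞 L) L))))]
  have h := tsum_eq_inv_measure_mul_tsum_adelicPiFourier (ν := ν4) ((mem_quatSchwartzBruhat_iff L _ Φ).1 hΦ)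
  refine Eq.trans (tsum_congr fun ξ => ?_) h
  rw [map_sum_smul_quatBasis_eq_quatCoord L hHa hdet ξ]

/-! ## §3 Poisson summation on `D_h` for the reduced-trace pairing `ψ_{L⁺}(trd(x y))` -/

omit [IsCMField L] [BorelSpace (AdeleRing (𝓞 ↥(maximalRealSubfield L)) ↥(maximalRealSubfield L))] [ν4.IsAddHaarMeasure] in
/-- **The trd-transform at rational arguments is a coordinate Fourier coefficient at `G η`**: for `η ∈ (L⁺)⁴` and any `G ∈ M₄(L⁺)`,
`quatFourierCoord L ν4 G e Φ (η ⊗ 1) = (Φ ∘ quatCoord e)^((G η) ⊗ 1)` — `(G ⊗ 1)(η ⊗ 1) = (G η) ⊗ 1` (Mathlib `RingHom.map_mulVec`).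
[cite: VignerasLNM800, Ch. II §4 (Φ*(x) = ∫ Φ(y) ψ(t(xy)) dy); Ch. III §2] -/
theorem quatFourierCoord_algebraMap (G : Matrix (Fin 4) (Fin 4) ↥(maximalRealSubfield L)) (e : Fin 4 → Matrix (Fin 2) (Fin 2) L)
    (Φ : Matrix (Fin 2) (Fin 2) (AdeleRing (𝓞 L) L) → ℂ) (η : Fin 4 → ↥(maximalRealSubfield L)) :
    quatFourierCoord L ν4 G e Φ
        (fun i => algebraMap (↥(maximalRealSubfield L)) (AdeleRing (𝓞 ↥(maximalRealSubfield L)) ↥(maximalRealSubfield L)) (η i)) =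
      adelicPiFourier (↥(maximalRealSubfield L)) (Fin 4) ν4 (fun a => Φ (quatCoord L e a))
        (fun i => algebraMap (↥(maximalRealSubfield L)) (AdeleRing (𝓞 ↥(maximalRealSubfield L)) ↥(maximalRealSubfield L)) ((G *ᵥ η) i)) := by
  unfold quatFourierCoord
  congr 1
  funext i
  rw [RingHom.map_mulVec]
  rfl

omit [BorelSpace (AdeleRing (𝓞 ↥(maximalRealSubfield L)) ↥(maximalRealSubfield L))] [ν4.IsAddHaarMeasure] in
/-- **Reindexing the dual sum by the Gram matrix**: since `G = quatGramReal ∈ GL₄(L⁺)` permutes the lattice `(L⁺)⁴` (★ `mulVec_quatGramReal_bijective`),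
`∑_{ξ ∈ (L⁺)⁴} (Φ ∘ quatCoord e)^(ξ ⊗ 1) = ∑_{η ∈ (L⁺)⁴} quatFourierCoord L ν4 G e Φ (η ⊗ 1)` (Mathlib `Equiv.tsum_eq` along `Equiv.ofBijective`).
[cite: VignerasLNM800, Ch. III §2 (formule de Poisson)] -/
theorem tsum_adelicPiFourier_eq_tsum_quatFourierCoord (hHa : (Ha.map (cmConjRingHom L)).transpose = Ha) (hdet : Ha.det ≠ 0)
    (Φ : Matrix (Fin 2) (Fin 2) (AdeleRing (𝓞 L) L) → ℂ) :
    ∑' ξ : Fin 4 → ↥(maximalRealSubfield L),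
        adelicPiFourier (↥(maximalRealSubfield L)) (Fin 4) ν4
          (fun a => Φ (quatCoord L (fun i => ((quatBasis L Ha hHa hdet i : ↥(quatRatSubalgebra L Ha)) : Matrix (Fin 2) (Fin 2) L)) a))
          (fun i => algebraMap (↥(maximalRealSubfield L)) (AdeleRing (𝓞 ↥(maximalRealSubfield L)) ↥(maximalRealSubfield L)) (ξ i)) =
      ∑' η : Fin 4 → ↥(maximalRealSubfield L),
        quatFourierCoord L ν4 (quatGramReal L hdet (coe_quatBasis_mem L Ha hHa hdet))
          (fun i => ((quatBasis L Ha hHa hdet i : ↥(quatRatSubalgebra L Ha)) : Matrix (Fin 2) (Fin 2) L)) Φ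
          (fun i => algebraMap (↥(maximalRealSubfield L)) (AdeleRing (𝓞 ↥(maximalRealSubfield L)) ↥(maximalRealSubfield L)) (η i)) := by
  rw [← Equiv.tsum_eq (Equiv.ofBijective _ (mulVec_quatGramReal_bijective L hHa hdet))]
  refine tsum_congr fun η => ?_
  rw [Equiv.ofBijective_apply, quatFourierCoord_algebraMap]

/-- **POISSON SUMMATION ON `D_h ⊂ D_{h,𝔸}` FOR THE REDUCED-TRACE PAIRING (lattice form, convention-free).**  For an additive Haar measure `ν4` on `𝔸⁺⁴` and
`Φ ∈ 𝒮(D_{h,𝔸})`: `∑_{x ∈ D_h} Φ(x ⊗ 1) = ν4(D⁴)⁻¹ · ∑_{η ∈ (L⁺)⁴} quatFourierCoord L ν4 G e Φ (η ⊗ 1)` with `G = quatGramReal` the Gram matrix of `trd` in the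
basis `e` — i.e. the dual side is the trd-Fourier transform `Φ̂(y) = ∫ Φ(x) ψ_{L⁺}(trd(x y)) dx` (★ `quatFourierCoord`, ★ `trace_quatCoord_mul_quatCoord`) evaluated along
the rational quaternions `y = ∑ ηᵢeᵢ`. [cite: VignerasLNM800, Ch. III §2 (proof of Thm. 2.2: ∑_{x ∈ X_K} Φ(x) = ∑_{x ∈ X_K} Φ*(x))] [cite: CasselsFrohlichANT1967, Ch. XV Lemma 4.2.4] -/
theorem tsum_quatRat_eq_inv_measure_mul_tsum_quatFourierCoord_coord (hHa : (Ha.map (cmConjRingHom L)).transpose = Ha) (hdet : Ha.det ≠ 0)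
    {Φ : Matrix (Fin 2) (Fin 2) (AdeleRing (𝓞 L) L) → ℂ}
    (hΦ : Φ ∈ quatSchwartzBruhat L (fun i => ((quatBasis L Ha hHa hdet i : ↥(quatRatSubalgebra L Ha)) : Matrix (Fin 2) (Fin 2) L))) :
    ∑' x : ↥(quatRatSubalgebra L Ha), Φ ((x : Matrix (Fin 2) (Fin 2) L).map (algebraMap L (AdeleRing (𝓞 L) L))) =
      (ν4 (piFundamentalDomain (↥(maximalRealSubfield L)) (Fin 4))).toReal⁻¹ *
        ∑' η : Fin 4 → ↥(maximalRealSubfield L),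
          quatFourierCoord L ν4 (quatGramReal L hdet (coe_quatBasis_mem L Ha hHa hdet))
            (fun i => ((quatBasis L Ha hHa hdet i : ↥(quatRatSubalgebra L Ha)) : Matrix (Fin 2) (Fin 2) L)) Φ
            (fun i => algebraMap (↥(maximalRealSubfield L)) (AdeleRing (𝓞 ↥(maximalRealSubfield L)) ↥(maximalRealSubfield L)) (η i)) := by
  rw [tsum_quatRat_eq_inv_measure_mul_tsum_adelicPiFourier L ν4 hHa hdet hΦ, tsum_adelicPiFourier_eq_tsum_quatFourierCoord L ν4 hHa hdet Φ]

/-- **POISSON SUMMATION ON `D_h ⊂ D_{h,𝔸}` FOR THE REDUCED-TRACE PAIRING (intrinsic form: both sides summed over `D_h`).**  For an additive Haar measure `ν4` on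
`𝔸⁺⁴` and `Φ ∈ 𝒮(D_{h,𝔸})`: `∑_{x ∈ D_h} Φ(x ⊗ 1) = ν4(D⁴)⁻¹ · ∑_{y ∈ D_h} Φ̂(y ⊗ 1)`, where for `y ∈ D_h` with coordinates `η = repr_e y ∈ (L⁺)⁴` the dual
term is `Φ̂(y ⊗ 1) := quatFourierCoord L ν4 G e Φ (η ⊗ 1) = ∫ Φ(x) ψ_{L⁺}(trd(x · (y ⊗ 1))) dx` (`x = quatCoord e a`, `dx = ν4`).  Tate's factor `ν4(D⁴)⁻¹` is `1`
exactly for the measures giving `𝔸⁺⁴ ∕ (L⁺)⁴` volume `1`; no self-duality is assumed.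
[cite: VignerasLNM800, Ch. III §2 (proof of Thm. 2.2)] [cite: CasselsFrohlichANT1967, Ch. XV Lemma 4.2.4; Thm. 4.2.1] [cite: WeilBNT1967, Ch. VII §2] -/
theorem tsum_quatRat_eq_inv_measure_mul_tsum_quatFourierCoord (hHa : (Ha.map (cmConjRingHom L)).transpose = Ha) (hdet : Ha.det ≠ 0)
    {Φ : Matrix (Fin 2) (Fin 2) (AdeleRing (𝓞 L) L) → ℂ}
    (hΦ : Φ ∈ quatSchwartzBruhat L (fun i => ((quatBasis L Ha hHa hdet i : ↥(quatRatSubalgebra L Ha)) : Matrix (Fin 2) (Fin 2) L))) :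
    ∑' x : ↥(quatRatSubalgebra L Ha), Φ ((x : Matrix (Fin 2) (Fin 2) L).map (algebraMap L (AdeleRing (𝓞 L) L))) =
      (ν4 (piFundamentalDomain (↥(maximalRealSubfield L)) (Fin 4))).toReal⁻¹ *
        ∑' y : ↥(quatRatSubalgebra L Ha),
          quatFourierCoord L ν4 (quatGramReal L hdet (coe_quatBasis_mem L Ha hHa hdet))
            (fun i => ((quatBasis L Ha hHa hdet i : ↥(quatRatSubalgebra L Ha)) : Matrix (Fin 2) (Fin 2) L)) Φ
            (fun i => algebraMap (↥(maximalRealSubfield L)) (AdeleRing (𝓞 ↥(maximalRealSubfield L)) ↥(maximalRealSubfield L))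
              ((quatBasis L Ha hHa hdet).repr y i)) := by
  rw [tsum_quatRat_eq_inv_measure_mul_tsum_quatFourierCoord_coord L ν4 hHa hdet hΦ,
    ← Equiv.tsum_eq (quatBasis L Ha hHa hdet).equivFun.toEquiv]
  rfl

end Poisson

end Summit.HodgeConjecture.HodgeConjecture.Cruxes.H413.K2E5QuatPoissonTransport

end
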